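import Summits.Langlands.Langlands.Theorems.PicardMuOrdinaryMuOrdinaryFamilyRTThornePointUnramified
import Literature.NumberTheory.GaloisRepresentations.ToLocalRestrictField
import HarnessLib

/-!
# PA-I glue H2 = G6a: a kill subgroup at `w ∈ S' ∖ 3` for the restricted point representation
# `ρ_y|Γ_{F'}` (stub of `stub_thorneInputOverL`, line thorne-minimal-lift)

Crux `Summit.Langlands.Langlands.Theses.PicardMuOrdinary.MuOrdinaryFamilyRT`, line
thorne-minimal-lift.  Hypothesis (iv)(b) of Thorne's Thm 5.1 at a place `w ∤ 3` of the CM field `F'`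
above `S₀` asks that an OPEN subgroup of the local inertia group `I_{F'_w}` act trivially through
`ρ_y|Γ_{F'}` (so that a soluble base change kills the finite inertial image).  The family is minimal
away from `3` (`PotUnramifiedFamily 𝓕`): at `v = w ∩ 𝓞 K ∈ S₀`, `v ∤ 3`, an open `U_v ≤ Γ_{K_v}` with
`𝓕.ρ(res_K^{K_v} τ) = 1` for `τ ∈ I_{K_v} ∩ U_v`.

* `exists_openSubgroup_restrictField_apply_eq_one_of_algebra` (§ 1, any framed `ρ : Γ_k → GL_n(A)`):
  a kill subgroup `U ≤ Γ_{k_v}` for `ρ` transports to the kill subgroup `res⁻¹(U) ≤ Γ_{L_w}` for `ρ|Γ_L`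
  along ANY `k`-compatible algebra structure `k_v → L_w` (Mathlib `OpenSubgroup.comap` of the continuous
  restriction `res = res_{k_v}^{L_w}`; the decomposition transport
  `res_k^L ∘ res_L^{L_w} = γ · (res_k^{k_v} ∘ res) · γ⁻¹`, `res(I_{L_w}) ⊆ I_{k_v}` of
  `exists_decompositionTransport_of_algebra`).
* `exists_killSubgroup_pointRep_restrictField` (§ 2, H2 = G6a, registered): for `ρy = y ∘ 𝓕.ρ`
  (`pointRep`), `w` a place of a number field `F' ⊇ K` with `w ∩ 𝓞 K ∈ S₀` and `w ∤ 3`, there is an open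
  `U ≤ Γ_{F'_w}` with `(ρy|Γ_{F'})(res_{F'}^{F'_w} τ) = 1` for all `τ ∈ I_{F'_w} ∩ U` — § 1 along the local
  base-change map `adicCompletionOfLiesOver K F' v w : K_v → F'_w` (`v = w.under (𝓞 K)`, `w ∣ v`
  tautologically, `liesOver_under`; scalar tower `isScalarTower_adicCompletionOfLiesOver`), with
  `v ∤ 3` from `w ∤ 3` (`natCast_mem_under_iff`).

References: J. Thorne, *A 2-adic automorphy lifting theorem for unitary groups over CM fields*,
Math. Z. 285 (2017), Thm 5.1 (iv); L. Clozel, M. Harris, R. Taylor, Publ. Math. IHÉS 108 (2008),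
Lemma 4.1.2; J.-P. Serre, *Abelian ℓ-adic representations* (1968), Ch. I §2.1.  No named fact, no
definition.
-/

set_option linter.dupNamespace false -- `Summit.Langlands.Langlands.…` is the problem's namespace

namespace Summit.Langlands.Langlands.Cruxes.MuOrdinaryFamilyRT.ThorneMinimalLift

open scoped NumberField Polynomial Matrix Classical
open Field IsDedekindDomain Polynomial
open Literature.NumberTheory.GaloisRepresentations Literature.NumberTheory.Automorphic
open Summit.Langlands.Langlands.Cruxes.MuOrdinaryFamilyRT.CharZeroDominance

noncomputable section

/-! ## 1. Transport of a kill subgroup along a `k`-compatible algebra structure `k_v → L_w` -/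

section General

variable {k : Type*} [Field k] [NumberField k] {A : Type*} [CommRing A] [TopologicalSpace A] {n : ℕ}

/-- **Kill subgroups transport along restriction.**  Let `ρ : Γ_k → GL_n(A)` and let `U ≤ Γ_{k_v}` be an
open subgroup with `ρ(res_k^{k_v} τ) = 1` for all `τ ∈ I_{k_v} ∩ U`.  For a number field `L ⊇ k`, a place
`w` of `L` and ANY `k`-compatible algebra structure `k_v → L_w`, the preimage `U' = res⁻¹(U) ≤ Γ_{L_w}` of
`U` under the continuous restriction `res = res_{k_v}^{L_w}` is open, and `(ρ|Γ_L)(res_L^{L_w} τ) = 1` for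
all `τ ∈ I_{L_w} ∩ U'`: `res_k^L(res_L^{L_w} τ) = γ · res_k^{k_v}(res τ) · γ⁻¹` and `res(I_{L_w}) ⊆ I_{k_v}`
(`exists_decompositionTransport_of_algebra`). -/
theorem exists_openSubgroup_restrictField_apply_eq_one_of_algebra {L : Type*} [Field L] [NumberField L]
    [Algebra k L] (ρ : FramedGaloisRep k A n) (v : HeightOneSpectrum (𝓞 k))
    (U : OpenSubgroup (absoluteGaloisGroup (v.adicCompletion k)))
    (hU : ∀ τ ∈ absInertia (v.adicCompletion k), τ ∈ U → ρ (absGaloisRestrict k (v.adicCompletion k) τ) = 1)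
    (w : HeightOneSpectrum (𝓞 L)) [Algebra (v.adicCompletion k) (w.adicCompletion L)]
    [IsScalarTower k (v.adicCompletion k) (w.adicCompletion L)] :
    ∃ U' : OpenSubgroup (absoluteGaloisGroup (w.adicCompletion L)),
      ∀ τ ∈ absInertia (w.adicCompletion L), τ ∈ U' →
        (ρ.restrictField L) (absGaloisRestrict L (w.adicCompletion L) τ) = 1 := by
  obtain ⟨γ, hγ, hI⟩ := exists_decompositionTransport_of_algebra (k := k) L v w
  refine ⟨U.comap (absGaloisRestrict (v.adicCompletion k) (w.adicCompletion L)).toMonoidHom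
      (absGaloisRestrict (v.adicCompletion k) (w.adicCompletion L)).continuous, fun τ hτ hτU => ?_⟩
  rw [FramedGaloisRep.restrictField_apply, hγ, map_mul, map_mul, map_inv,
    hU _ (hI τ hτ) (OpenSubgroup.mem_comap.mp hτU), mul_one, mul_inv_cancel]

end General

/-! ## 2. H2 = G6a: the kill subgroup at `w ∈ S' ∖ 3` for `ρ_y|Γ_{F'}` -/

/-- **H2 = G6a** (PA-I glue of `stub_thorneInputOverL`).  Let `𝓕 : OrdFamily f ι e S₀ ρ_C` be minimal
away from `3` (`PotUnramifiedFamily 𝓕`), `ρy` a framing of the point representation `pointRep 𝓕 y`, `F' ⊇ K`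
a number field and `w` a place of `F'` with `w ∩ 𝓞 K ∈ S₀` and `w ∤ 3`.  Then some open subgroup
`U ≤ Γ_{F'_w}` of local inertia acts trivially through `ρy|Γ_{F'}`: transport the kill subgroup of
`PotUnramifiedFamily 𝓕` at `v = w.under (𝓞 K)` (`v ∤ 3` by `natCast_mem_under_iff`) along the local
base-change map `K_v → F'_w` (`adicCompletionOfLiesOver`, a `K`-compatible algebra structure by
`isScalarTower_adicCompletionOfLiesOver`), § 1, and push `𝓕.ρ(…) = 1` through `y`. -/
theorem exists_killSubgroup_pointRep_restrictField : ∀ (f : ℤ[X]) (ι : PadicAlgCl 3 ≃+* ℂ) (e : K →+* ℂ) (S₀ : Finset (HeightOneSpectrum (𝓞 K))) (ρC : FramedGaloisRep K (PadicAlgCl 3) 3) (𝓕 : OrdFamily f ι e S₀ ρC), PotUnramifiedFamily 𝓕 → ∀ (F' : Type) [Field F'] [NumberField F'] [Algebra K F'] (y : 𝓕.R →+* PadicAlgCl 3) (ρy : FramedGaloisRep K (PadicAlgCl 3) 3), (∀ g, ρy g = pointRep 𝓕 y g) → ∀ w : HeightOneSpectrum (𝓞 F'), w.under (𝓞 K)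 ∈ S₀ → ((3 : ℕ) : 𝓞 F') ∉ w.asIdeal → ∃ U : OpenSubgroup (absoluteGaloisGroup (w.adicCompletion F')), ∀ τ ∈ absInertia (w.adicCompletion F'), τ ∈ U → (ρy.restrictField F') (absGaloisRestrict F' (w.adicCompletion F') τ) = 1 := by
  intro f ι e S₀ ρC 𝓕 hpur F' _ _ _ y ρy hρy w hw hw3
  have hv3 : ((3 : ℕ) : 𝓞 K) ∉ (w.under (𝓞 K)).asIdeal := by rwa [natCast_mem_under_iff]
  obtain ⟨U, hU⟩ := hpur _ hw hv3
  haveI : w.asIdeal.LiesOver (w.under (𝓞 K)).asIdeal := liesOver_under w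
  letI := (adicCompletionOfLiesOver K F' (w.under (𝓞 K)) w).toAlgebra
  haveI := isScalarTower_adicCompletionOfLiesOver (F := K) (E := F') (w.under (𝓞 K)) w
  refine exists_openSubgroup_restrictField_apply_eq_one_of_algebra ρy (w.under (𝓞 K)) U
    (fun τ hτ hτU => ?_) w
  rw [hρy]
  change Matrix.GeneralLinearGroup.map y (𝓕.ρ (absGaloisRestrict K ((w.under (𝓞 K)).adicCompletion K) τ)) = 1
  rw [hU τ hτ hτU, map_one]

end

end Summit.Langlands.Langlands.Cruxes.MuOrdinaryFamilyRT.ThorneMinimalLift
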